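import Summits.SmoothPoincare4.SmoothPoincare4.Theorems.EntropyRungBakryEmeryLogSobolevFisherPointwise
import Summits.SmoothPoincare4.SmoothPoincare4.Theorems.EntropyRungNoncompactShrinkerGapHeatDissipationCutoff
import HarnessLib

/-!
# Exponential decay of the Fisher information along the weighted heat flow on a complete
# `CD(K, ∞)` manifold, with first-order (Gaffney) cut-offs
# (support item `EntropyRung.BakryEmeryLogSobolev`, stmt-SmoothPoincare4-16587)

Setting: `M` modelled on `ℝⁿ` (Hausdorff, second countable, `T₃`, Borel — NOT compact), `g`
Riemannian with its Levi-Civita connection, `V` smooth with `Ric + Hess V ≥ K g` and `e^{-V} ∈ L¹`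
(NO other assumption on `V`), `L = Δ_g − g⁻¹(dV, d·)`; Gaffney cut-offs `η_k ∈ C_c^∞`, `0 ≤ η_k ≤ 1`,
`η_k(x) = 1` for large `k`, `|∇η_k|² ≤ C₀/(k+1)²`.

**Theorem** (`gaffney_fisherDecay`). Let `u` be smooth on `M × O` (`O ⊇ [0, T]` open) with
`∂ₛu = Lu` on `[0, T]`, `a ≤ u ≤ b` (`a > 0`) and `|∇u|² ≤ C_G` on `[0, T] × M` (the a priori bounds of
`gaffney_maxPrinciple` and `gaffney_gradientDecay`). Then the Fisher information
`I(t) = ∫ |∇u(t)|²/u(t) e^{-V} dV_g` satisfies `I(t) ≤ e^{-2Kt} I(0)` for `t ∈ [0, T]`.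

Proof (Bakry–Émery 1985; BGL 2014, Prop. 5.7.1; Carrillo–Ni 2009, §3): with `φ = −log u`
(`negLog_heat_equation`: `∂ₜφ = Lφ − |∇φ|²` within `[0, T]`), `|∇φ|²e^{-φ} = |∇u|²/u`, and the cut-off
Fisher informations `A_k(t) = ∫ η_k² |∇φ|² e^{-φ} e^{-V}`, the first-order dissipation inequality
`fisher_cutoffSq_le` gives `A_k' ≤ −2K A_k + ε_k J`, `ε_k = 2δ_k² + 2δ_k L₀ → 0` (`δ_k² = C₀/(k+1)²`,
`L₀² = C_G/a²`, `J ≤ (C_G/a) ∫e^{-V}`), so `t ↦ e^{2Kt}A_k(t) − t e^{2|K|T} ε_k J_max` is non-increasing on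
`[0, T]`; letting `k → ∞` (dominated convergence) yields `e^{2Kt} I(t) ≤ I(0)`. Everything is proved; no
definitions, no named facts.

## References

* [BakryGentilLedoux2014] D. Bakry, I. Gentil, M. Ledoux (2014), Prop. 5.7.1 (p. 268), §3.2 (pp. 141–147).
* [BakryEmery1985] D. Bakry, M. Émery, LNM 1123 (1985) 177–206.
* [CarrilloNi2009] J. A. Carrillo, L. Ni, Comm. Anal. Geom. 17 (2009), §3 (3.2)–(3.4), p. 8.
-/

noncomputable section

set_option linter.dupNamespace false

open scoped Manifold ContDiff ENNReal NNReal Topology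
open MeasureTheory Set Filter
open Literature.Geometry.Lorentzian Literature.Geometry.Riemannian

namespace Summit.SmoothPoincare4.SmoothPoincare4.Theorems.BakryEmeryComplete

open NoncompactShrinkerGapHeat NoncompactShrinkerGapHeat.CutoffToolkit

section FisherDecay

variable {n : ℕ} {M : Type*} [TopologicalSpace M] [T2Space M] [SecondCountableTopology M]
  [ChartedSpace (EuclideanSpace ℝ (Fin n)) M] [IsManifold (𝓡 n) ∞ M] [T3Space M]
  [MeasurableSpace M] [BorelSpace M]
  {g : PseudoRiemannianMetric (𝓡 n) ∞ (EuclideanSpace ℝ (Fin n)) (TangentSpace (𝓡 n) : M → Type _)}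
  [g.HasLeviCivita]

/-- **Exponential decay of the Fisher information along the weighted heat flow on a complete
`CD(K,∞)` manifold** (see the module docstring): for `u` smooth on `M × O`, `∂ₛu = Lu` on `[0,T]`,
`0 < a ≤ u ≤ b`, `|∇u|² ≤ C_G` on `[0,T] × M`, `e^{-V} ∈ L¹`, and Gaffney cut-offs,
`∫ |∇u(t)|²/u(t) e^{-V} ≤ e^{-2Kt} ∫ |∇u(0)|²/u(0) e^{-V}` for `t ∈ [0, T]`.
[cite: BakryGentilLedoux2014, Prop. 5.7.1 (p. 268)] [cite: BakryEmery1985]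
[cite: CarrilloNi2009, §3 (3.2)–(3.4), p. 8] -/
theorem gaffney_fisherDecay (hg : g.IsRiemannian) {V : M → ℝ} {K : ℝ}
    (hV : ContMDiff (𝓡 n) 𝓘(ℝ, ℝ) ∞ V)
    (hRic : ∀ (y : M) (X : TangentSpace (𝓡 n) y), K * g.val y X X ≤ g.ricci y X X + g.hessian V y X X)
    (hw : Integrable (fun y ↦ Real.exp (-V y)) g.riemVolume)
    {η : ℕ → M → ℝ} {C₀ : ℝ} (hηs : ∀ k, ContMDiff (𝓡 n) 𝓘(ℝ, ℝ) ∞ (η k))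
    (hηc : ∀ k, HasCompactSupport (η k)) (hη01 : ∀ k x, 0 ≤ η k x ∧ η k x ≤ 1)
    (hη1 : ∀ x, ∀ᶠ k in atTop, η k x = 1)
    (hηgrad : ∀ k x, g.gradSq (η k) x ≤ C₀ / ((k : ℝ) + 1) ^ 2)
    {T : ℝ} {O : Set ℝ} {u : ℝ → M → ℝ} (hT : 0 < T) (hO : IsOpen O) (hTO : Icc 0 T ⊆ O)
    (hu : ContMDiffOn ((𝓡 n).prod 𝓘(ℝ, ℝ)) 𝓘(ℝ, ℝ) ∞ (fun p : M × ℝ ↦ u p.2 p.1) (univ ×ˢ O))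
    (heq : ∀ s ∈ Icc 0 T, ∀ x, deriv (fun r ↦ u r x) s = g.dalembertian (u s) x
      - g.innerDual x (mvfderiv (𝓡 n) V x).toLinearMap (mvfderiv (𝓡 n) (u s) x).toLinearMap)
    {a b CG : ℝ} (ha : 0 < a) (hab : ∀ s ∈ Icc 0 T, ∀ x, a ≤ u s x ∧ u s x ≤ b)
    (hG : ∀ s ∈ Icc 0 T, ∀ x, g.gradSq (u s) x ≤ CG) :
    ∀ t ∈ Icc 0 T, ∫ y, g.gradSq (u t) y / u t y * Real.exp (-V y) ∂g.riemVolume ≤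
      Real.exp (-2 * K * t) * ∫ y, g.gradSq (u 0) y / u 0 y * Real.exp (-V y) ∂g.riemVolume := by
  intro t₀ ht₀
  haveI := CarrilloNi2009_shrinkerLSI.isFiniteMeasureOnCompacts_riemVolume hg
  set μ : Measure M := g.riemVolume with hμ
  -- the time set `S = [0, T]`
  set S : Set ℝ := Icc 0 T with hSdef
  have hS : UniqueDiffOn ℝ S := uniqueDiffOn_Icc hT
  have hS' : S ⊆ closure (interior S) := by rw [hSdef, interior_Icc, closure_Ioo hT.ne]
  have huS : ContMDiffOn ((𝓡 n).prod 𝓘(ℝ, ℝ)) 𝓘(ℝ, ℝ) ∞ (fun p : M × ℝ ↦ u p.2 p.1) (univ ×ˢ S) :=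
    hu.mono (prod_mono le_rfl hTO)
  have hpos : ∀ t ∈ S, ∀ y, 0 < u t y := fun t ht y ↦ ha.trans_le (hab t ht y).1
  have hslice : ∀ t ∈ S, ContMDiff (𝓡 n) 𝓘(ℝ, ℝ) ∞ (u t) := fun t ht ↦
    huS.comp_contMDiff (contMDiff_id.prodMk contMDiff_const) fun y ↦ ⟨mem_univ _, ht⟩
  -- the equation within `S`, and the equation of `φ = −log u`
  have hdS : ∀ t ∈ S, ∀ y, HasDerivAt (fun r ↦ u r y) (deriv (fun r ↦ u r y) t) t := fun t ht y ↦
    hasDerivAt_slice_of_contMDiffOn hO (v := fun p : M × ℝ ↦ u p.2 p.1) hu y (hTO ht)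
  have heqS : ∀ t ∈ S, ∀ y, derivWithin (fun r ↦ u r y) S t = g.dalembertian (u t) y
      - g.innerDual y (mvfderiv (𝓡 n) V y).toLinearMap (mvfderiv (𝓡 n) (u t) y).toLinearMap := by
    intro t ht y
    rw [(hdS t ht y).differentiableAt.derivWithin (hS t ht)]
    exact heq t ht y
  set φ : ℝ → M → ℝ := fun t y ↦ -Real.log (u t y) with hφdef
  have hφ : ContMDiffOn ((𝓡 n).prod 𝓘(ℝ, ℝ)) 𝓘(ℝ, ℝ) ∞ (fun p : M × ℝ ↦ φ p.2 p.1) (univ ×ˢ S) := by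
    intro p hp
    have hne : u p.2 p.1 ≠ 0 := (hpos p.2 hp.2 p.1).ne'
    exact ((Real.contDiffAt_log.2 hne).comp_contMDiffWithinAt (f := fun p : M × ℝ ↦ u p.2 p.1) (x := p)
      (huS p hp)).neg
  have heqφ : ∀ t ∈ S, ∀ y : M, derivWithin (fun s ↦ φ s y) S t =
      g.dalembertian (φ t) y
        - g.innerDual y (mvfderiv (𝓡 n) V y).toLinearMap (mvfderiv (𝓡 n) (φ t) y).toLinearMap
        - g.gradSq (φ t) y := by
    intro t ht y
    have hut : ContMDiffAt (𝓡 n) 𝓘(ℝ, ℝ) 2 (u t) y :=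
      ((hslice t ht).of_le (WithTop.coe_le_coe.mpr le_top)).contMDiffAt
    have hd : HasDerivWithinAt (fun s ↦ u s y) (derivWithin (fun s ↦ u s y) S t) S t :=
      hasDerivWithinAt_time_of_contMDiffOn (by simp) huS y ht
    exact negLog_heat_equation g hut (hpos t ht y) hd (hS t ht) (heqS t ht y)
  have hφslice : ∀ t ∈ S, ContMDiff (𝓡 n) 𝓘(ℝ, ℝ) ∞ (φ t) := fun t ht ↦
    hφ.comp_contMDiff (contMDiff_id.prodMk contMDiff_const) fun y ↦ ⟨mem_univ _, ht⟩
  -- the Fisher integrand `F(t, y) = |∇φ|² e^{-φ} e^{-V} = |∇u|²/u e^{-V}`, jointly smooth on `M × S`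
  have hFfam : ContMDiffOn ((𝓡 n).prod 𝓘(ℝ, ℝ)) 𝓘(ℝ, ℝ) ∞ (fun p : M × ℝ ↦
      g.gradSq (φ p.2) p.1 * Real.exp (-φ p.2 p.1) * Real.exp (-V p.1)) (univ ×ˢ S) := by
    have hq := contMDiffOn_gradSq_family g hS (f := φ) hφ
    have he : ContMDiffOn ((𝓡 n).prod 𝓘(ℝ, ℝ)) 𝓘(ℝ, ℝ) ∞ (fun p : M × ℝ ↦ Real.exp (-φ p.2 p.1))
        (univ ×ˢ S) := (Real.contDiff_exp.comp contDiff_neg).contMDiff.comp_contMDiffOn hφ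
    have hwf : ContMDiffOn ((𝓡 n).prod 𝓘(ℝ, ℝ)) 𝓘(ℝ, ℝ) ∞ (fun p : M × ℝ ↦ Real.exp (-V p.1)) (univ ×ˢ S) :=
      ((Real.contDiff_exp.comp contDiff_neg).comp_contMDiff (hV.comp contMDiff_fst)).contMDiffOn
    exact (hq.mul he).mul hwf
  have hF'fam := contMDiffOn_derivWithin_time_of_uniqueDiffOn (u := fun t y ↦
      g.gradSq (φ t) y * Real.exp (-φ t y) * Real.exp (-V y)) hS hFfam
  have hFu : ∀ t ∈ S, ∀ y, g.gradSq (φ t) y * Real.exp (-φ t y) = g.gradSq (u t) y / u t y := fun t ht y ↦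
    gradSq_negLog_mul_exp ((hslice t ht).mdifferentiableAt (by simp)) (hpos t ht y)
  -- constants
  have hCG0 : ∀ y : M, 0 ≤ CG := fun y ↦ (g.gradSq_nonneg hg _ y).trans (hG 0 ⟨le_rfl, hT.le⟩ y)
  have hC₀ : ∀ y : M, 0 ≤ C₀ := fun y ↦ by
    have h1 := hηgrad 0 y
    have h2 : 0 ≤ g.gradSq (η 0) y := g.gradSq_nonneg hg _ _
    rcases div_nonneg_iff.1 (h2.trans h1) with h | h
    · exact h.1
    · exact absurd h.2 (not_le.mpr (by positivity))
  -- the pointwise bounds: `0 ≤ F ≤ (C_G/a) e^{-V}`, `|∇φ|² ≤ C_G/a²`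
  have hFbd : ∀ t ∈ S, ∀ y, 0 ≤ g.gradSq (φ t) y * Real.exp (-φ t y) ∧
      g.gradSq (φ t) y * Real.exp (-φ t y) ≤ CG / a := by
    intro t ht y
    rw [hFu t ht y]
    have hρy := hab t ht y
    have hGy := hG t ht y
    have hQ0 : 0 ≤ g.gradSq (u t) y := g.gradSq_nonneg hg _ _
    have hρpos := hpos t ht y
    refine ⟨div_nonneg hQ0 hρpos.le, ?_⟩
    rw [div_le_div_iff₀ hρpos ha]
    nlinarith
  have hgradφ : ∀ t ∈ S, ∀ y, g.gradSq (φ t) y ≤ (Real.sqrt CG / a) ^ 2 := by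
    intro t ht y
    have h := hFu t ht y
    have hρpos := hpos t ht y
    have hex : Real.exp (-φ t y) = u t y := by simp only [hφdef, neg_neg, Real.exp_log hρpos]
    rw [hex] at h
    have h2 : g.gradSq (φ t) y = g.gradSq (u t) y / u t y ^ 2 := by
      field_simp at h ⊢
      linarith [h]
    rw [h2, div_pow, Real.sq_sqrt (hCG0 y), div_le_div_iff₀ (pow_pos hρpos 2) (pow_pos ha 2)]
    have h3 := hG t ht y
    have h4 : a ^ 2 ≤ u t y ^ 2 := pow_le_pow_left₀ ha.le (hab t ht y).1 2
    nlinarith [g.gradSq_nonneg hg (u t) y]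
  -- the full Fisher information `J`, bounded by `J_max`
  have hWc : Continuous fun y ↦ Real.exp (-V y) := Real.continuous_exp.comp hV.continuous.neg
  have hFc : ∀ t ∈ S, Continuous fun y ↦ g.gradSq (φ t) y * Real.exp (-φ t y) * Real.exp (-V y) := fun t ht ↦
    (hFfam.continuousOn.comp_continuous (continuous_id.prodMk continuous_const) fun y ↦ ⟨mem_univ _, ht⟩ :)
  have hFint : ∀ t ∈ S, Integrable (fun y ↦ g.gradSq (φ t) y * Real.exp (-φ t y) * Real.exp (-V y)) μ := by
    intro t ht
    refine (hw.const_mul (CG / a)).mono' (hFc t ht).aestronglyMeasurable (Eventually.of_forall fun y ↦ ?_)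
    rw [Real.norm_eq_abs, abs_of_nonneg (mul_nonneg (hFbd t ht y).1 (Real.exp_pos _).le)]
    exact mul_le_mul_of_nonneg_right (hFbd t ht y).2 (Real.exp_pos _).le
  set J : ℝ → ℝ := fun t ↦ ∫ y, g.gradSq (φ t) y * Real.exp (-φ t y) * Real.exp (-V y) ∂μ with hJdef
  set Jmax : ℝ := CG / a * ∫ y, Real.exp (-V y) ∂μ with hJmax
  have hJ0 : ∀ t ∈ S, 0 ≤ J t := fun t ht ↦ integral_nonneg fun y ↦ mul_nonneg (hFbd t ht y).1 (Real.exp_pos _).le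
  have hJle : ∀ t ∈ S, J t ≤ Jmax := by
    intro t ht
    calc J t ≤ ∫ y, CG / a * Real.exp (-V y) ∂μ :=
          integral_mono (hFint t ht) (hw.const_mul _) fun y ↦
            mul_le_mul_of_nonneg_right (hFbd t ht y).2 (Real.exp_pos _).le
      _ = Jmax := integral_const_mul _ _
  have hJmax0 : 0 ≤ Jmax := (hJ0 0 ⟨le_rfl, hT.le⟩).trans (hJle 0 ⟨le_rfl, hT.le⟩)
  -- the cut-off Fisher informations `A k`, their derivatives `DA k`, the error sizes `ε k`
  set A : ℕ → ℝ → ℝ := fun k t ↦ ∫ y, η k y ^ 2 * (g.gradSq (φ t) y * Real.exp (-φ t y) * Real.exp (-V y)) ∂μ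
    with hAdef
  set DA : ℕ → ℝ → ℝ := fun k t ↦ ∫ y, η k y ^ 2 * derivWithin (fun s ↦ g.gradSq (φ s) y *
      Real.exp (-φ s y) * Real.exp (-V y)) S t ∂μ with hDAdef
  set δ : ℕ → ℝ := fun k ↦ Real.sqrt C₀ / ((k : ℝ) + 1) with hδdef
  set L₀ : ℝ := Real.sqrt CG / a with hL₀
  have hL₀0 : 0 ≤ L₀ := div_nonneg (Real.sqrt_nonneg _) ha.le
  have hδ0 : ∀ k, 0 ≤ δ k := fun k ↦ div_nonneg (Real.sqrt_nonneg _) (by positivity)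
  have hδgrad : ∀ k y, g.gradSq (η k) y ≤ δ k ^ 2 := fun k y ↦ by
    simp only [hδdef]
    rw [div_pow, Real.sq_sqrt (hC₀ y)]
    exact hηgrad k y
  set ε : ℕ → ℝ := fun k ↦ 2 * δ k ^ 2 + 2 * δ k * L₀ with hεdef
  have hε0 : ∀ k, 0 ≤ ε k := fun k ↦ by positivity
  have hηabs : ∀ k y, |η k y| ≤ 1 := fun k y ↦ abs_le.2 ⟨by linarith [(hη01 k y).1], (hη01 k y).2⟩
  -- (f1) the dissipation inequality
  have f1 : ∀ k, ∀ t ∈ S, DA k t ≤ -2 * K * A k t + ε k * J t := fun k t ht ↦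
    fisher_cutoffSq_le hg hV hRic hS hS' hφ heqφ (hηs k) (hηc k) (hηabs k) (hδ0 k) (hδgrad k) ht hL₀0
      (hgradφ t ht) (hFint t ht)
  -- (f6), (f7): continuity on `S`, differentiability on the interior, under the integral sign
  have hη2 : ∀ k, Continuous fun y ↦ η k y ^ 2 := fun k ↦ (hηs k).continuous.pow 2
  have hη2c : ∀ k, HasCompactSupport (fun y ↦ η k y ^ 2) := fun k ↦ by
    rw [show (fun y ↦ η k y ^ 2) = fun y ↦ η k y * η k y from funext fun y ↦ sq (η k y)]
    exact (hηc k).mul_right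
  have hswapF : ContinuousOn (Function.uncurry fun t y ↦ g.gradSq (φ t) y * Real.exp (-φ t y) *
      Real.exp (-V y)) (S ×ˢ univ) := by
    have h1 := hFfam.continuousOn.comp continuous_swap.continuousOn
      (fun (q : ℝ × M) (hq : q ∈ S ×ˢ (univ : Set M)) ↦ show q.swap ∈ univ ×ˢ S from ⟨mem_univ _, hq.1⟩)
    exact h1.congr (by rintro ⟨t, y⟩ _; rfl)
  have hswapF' : ContinuousOn (Function.uncurry fun t y ↦ derivWithin (fun s ↦ g.gradSq (φ s) y *
      Real.exp (-φ s y) * Real.exp (-V y)) S t) (Ioo 0 T ×ˢ univ) := by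
    have h1 := hF'fam.continuousOn.comp continuous_swap.continuousOn
      (fun (q : ℝ × M) (hq : q ∈ Ioo 0 T ×ˢ (univ : Set M)) ↦
        show q.swap ∈ univ ×ˢ S from ⟨mem_univ _, Ioo_subset_Icc_self hq.1⟩)
    exact h1.congr (by rintro ⟨t, y⟩ _; rfl)
  have f6 : ∀ k, ContinuousOn (A k) S := fun k ↦ by
    have h := Literature.Analysis.FluidPDE.continuousOn_integral_smul_of_continuousOn (μ := μ)
      (hη2 k) (hη2c k) hswapF
    simp only [smul_eq_mul] at h
    exact h
  have f7 : ∀ k, ∀ t ∈ Ioo 0 T, HasDerivAt (A k) (DA k t) t := by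
    intro k t ht
    have hder : ∀ s ∈ Ioo 0 T, ∀ y, HasDerivAt (fun r ↦ g.gradSq (φ r) y * Real.exp (-φ r y) * Real.exp (-V y))
        (derivWithin (fun r ↦ g.gradSq (φ r) y * Real.exp (-φ r y) * Real.exp (-V y)) S s) s :=
      fun s hs y ↦ (hasDerivWithinAt_time_of_contMDiffOn (k := ∞) (u := fun t y ↦ g.gradSq (φ t) y *
        Real.exp (-φ t y) * Real.exp (-V y)) (by simp) hFfam y (Ioo_subset_Icc_self hs)).hasDerivAt
        (Icc_mem_nhds hs.1 hs.2)
    have h := Literature.Analysis.FluidPDE.hasDerivAt_integral_smul_of_continuousOn (μ := μ)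
      (hη2 k) (hη2c k) isOpen_Ioo (hswapF.mono (prod_mono Ioo_subset_Icc_self le_rfl)) hswapF' hder ht
    simp only [smul_eq_mul] at h
    exact h
  -- the exponential weight
  set CK : ℝ := Real.exp (2 * |K| * T) with hCK
  have hexle : ∀ t ∈ S, Real.exp (2 * K * t) ≤ CK := fun t ht ↦ by
    refine Real.exp_le_exp.2 ?_
    have h1 : 2 * K * t ≤ 2 * |K| * t := by nlinarith [le_abs_self K, ht.1]
    have h2 : 2 * |K| * t ≤ 2 * |K| * T := by nlinarith [abs_nonneg K, ht.2]
    linarith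
  have hexd : ∀ t, HasDerivAt (fun s ↦ Real.exp (2 * K * s)) (Real.exp (2 * K * t) * (2 * K)) t := fun t ↦ by
    have h1 : HasDerivAt (fun s : ℝ ↦ 2 * K * s) (2 * K) t := by simpa using (hasDerivAt_id t).const_mul (2 * K)
    exact h1.exp
  -- (main) `e^{2Kt} A_k(t) ≤ A_k(0) + t CK ε_k J_max` on `S`
  have hmain : ∀ k, ∀ t ∈ S, Real.exp (2 * K * t) * A k t ≤ A k 0 + t * (CK * ε k * Jmax) := by
    intro k t ht
    set Θ : ℝ → ℝ := fun s ↦ Real.exp (2 * K * s) * A k s - s * (CK * ε k * Jmax) with hΘ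
    have hcontΘ : ContinuousOn Θ S :=
      ((Real.continuous_exp.comp (continuous_const.mul continuous_id)).continuousOn.mul (f6 k)).sub
        (continuous_id.mul continuous_const).continuousOn
    have hdiffΘ : ∀ s ∈ Ioo 0 T, HasDerivAt Θ (Real.exp (2 * K * s) * (2 * K) * A k s
        + Real.exp (2 * K * s) * DA k s - CK * ε k * Jmax) s := fun s hs ↦ by
      have h1 : HasDerivAt (fun s' ↦ Real.exp (2 * K * s') * A k s')
          (Real.exp (2 * K * s) * (2 * K) * A k s + Real.exp (2 * K * s) * DA k s) s :=
        (hexd s).mul (f7 k s hs)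
      have h2 : HasDerivAt (fun s' : ℝ ↦ s' * (CK * ε k * Jmax)) (CK * ε k * Jmax) s := by
        simpa using hasDerivAt_mul_const (CK * ε k * Jmax) (x := s)
      exact h1.sub h2
    have hΘanti : AntitoneOn Θ S := by
      refine antitoneOn_of_deriv_nonpos (convex_Icc 0 T) hcontΘ (fun s hs ↦ ?_) (fun s hs ↦ ?_)
      · rw [interior_Icc] at hs
        exact (hdiffΘ s hs).differentiableAt.differentiableWithinAt
      · rw [interior_Icc] at hs
        have hsS : s ∈ S := Ioo_subset_Icc_self hs
        rw [(hdiffΘ s hs).deriv]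
        have h1 := f1 k s hsS
        have hexp0 : 0 ≤ Real.exp (2 * K * s) := (Real.exp_pos _).le
        have h2 : Real.exp (2 * K * s) * DA k s ≤ Real.exp (2 * K * s) * (-2 * K * A k s + ε k * J s) :=
          mul_le_mul_of_nonneg_left h1 hexp0
        have h3 : Real.exp (2 * K * s) * (ε k * J s) ≤ CK * (ε k * Jmax) :=
          mul_le_mul (hexle s hsS) (mul_le_mul_of_nonneg_left (hJle s hsS) (hε0 k))
            (mul_nonneg (hε0 k) (hJ0 s hsS)) (Real.exp_pos _).le
        nlinarith [h2, h3]
    have h0S : (0 : ℝ) ∈ S := ⟨le_rfl, hT.le⟩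
    have hΘle : Θ t ≤ Θ 0 := hΘanti h0S ht ht.1
    simp only [hΘ, mul_zero, Real.exp_zero, one_mul, zero_mul, sub_zero] at hΘle
    linarith
  -- `A_k(0) ≤ J(0)`
  have hsq1 : ∀ k y, η k y ^ 2 ≤ 1 := fun k y ↦ pow_le_one₀ (hη01 k y).1 (hη01 k y).2
  have hA0 : ∀ k, A k 0 ≤ J 0 := fun k ↦ by
    refine integral_mono_of_nonneg (Eventually.of_forall fun y ↦ ?_) (hFint 0 ⟨le_rfl, hT.le⟩)
      (Eventually.of_forall fun y ↦ ?_)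
    · exact mul_nonneg (sq_nonneg _) (mul_nonneg (hFbd 0 ⟨le_rfl, hT.le⟩ y).1 (Real.exp_pos _).le)
    · exact mul_le_of_le_one_left (mul_nonneg (hFbd 0 ⟨le_rfl, hT.le⟩ y).1 (Real.exp_pos _).le) (hsq1 k y)
  -- `k → ∞`: `A_k(t₀) → J(t₀)` and `ε_k → 0`
  have hlimA : Tendsto (fun k ↦ A k t₀) atTop (𝓝 (J t₀)) := by
    refine tendsto_integral_of_dominated_convergence _ (fun k ↦ ((hη2 k).mul (hFc t₀ ht₀)).aestronglyMeasurable)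
      (hFint t₀ ht₀) (fun k ↦ Eventually.of_forall fun y ↦ ?_) (Eventually.of_forall fun y ↦ ?_)
    · have h0 := mul_nonneg (hFbd t₀ ht₀ y).1 (Real.exp_pos (-V y)).le
      rw [Real.norm_eq_abs, abs_of_nonneg (mul_nonneg (sq_nonneg _) h0)]
      exact mul_le_of_le_one_left h0 (hsq1 k y)
    · have h := (tendsto_cutoff_of_eventually_eq hη1 y).pow 2
      simpa using h.mul_const (g.gradSq (φ t₀) y * Real.exp (-φ t₀ y) * Real.exp (-V y))
  have hlimε : Tendsto ε atTop (𝓝 0) := by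
    have h1 : Tendsto (fun k : ℕ ↦ (k : ℝ) + 1) atTop atTop :=
      tendsto_atTop_add_const_right _ 1 (tendsto_natCast_atTop_atTop (R := ℝ))
    have hδ : Tendsto δ atTop (𝓝 0) := tendsto_const_nhds.div_atTop h1
    have h := ((hδ.pow 2).const_mul 2).add ((hδ.mul_const L₀).const_mul 2)
    simp only [mul_zero, zero_pow two_ne_zero, zero_mul, add_zero] at h
    refine h.congr fun k ↦ ?_
    simp only [hεdef]; ring
  have hlimR : Tendsto (fun k ↦ J 0 + t₀ * (CK * ε k * Jmax)) atTop (𝓝 (J 0 + t₀ * (CK * 0 * Jmax))) :=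
    tendsto_const_nhds.add (((hlimε.const_mul CK).mul_const Jmax).const_mul t₀)
  have hfin : Real.exp (2 * K * t₀) * J t₀ ≤ J 0 := by
    have h1 : Tendsto (fun k ↦ Real.exp (2 * K * t₀) * A k t₀) atTop (𝓝 (Real.exp (2 * K * t₀) * J t₀)) :=
      hlimA.const_mul _
    have h2 := le_of_tendsto_of_tendsto' h1 hlimR fun k ↦ (hmain k t₀ ht₀).trans (by linarith [hA0 k])
    simpa using h2
  -- back to `u`
  have hJu : ∀ t ∈ S, J t = ∫ y, g.gradSq (u t) y / u t y * Real.exp (-V y) ∂μ := fun t ht ↦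
    integral_congr_ae (Eventually.of_forall fun y ↦ by dsimp only; rw [hFu t ht y])
  rw [← hJu t₀ ht₀, ← hJu 0 ⟨le_rfl, hT.le⟩]
  have hinv : Real.exp (-2 * K * t₀) * Real.exp (2 * K * t₀) = 1 := by
    rw [← Real.exp_add, show -2 * K * t₀ + 2 * K * t₀ = 0 by ring, Real.exp_zero]
  calc J t₀ = Real.exp (-2 * K * t₀) * (Real.exp (2 * K * t₀) * J t₀) := by rw [← mul_assoc, hinv, one_mul]
    _ ≤ Real.exp (-2 * K * t₀) * J 0 := mul_le_mul_of_nonneg_left hfin (Real.exp_pos _).le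

end FisherDecay

end Summit.SmoothPoincare4.SmoothPoincare4.Theorems.BakryEmeryComplete

end
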